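import Summits.CriticalPhenomena.PercolationContinuityZ3.Theorems.Transplant.SiteVdBHK
import HarnessLib

/-!
# SITE percolation: two clusters given `{s ↮ t}` (site version of van den Berg–Häggström–Kahn 2006, Thms 1.4–1.5)
# (lane `prim-bschramm`, class C1a, item (U1) — second half)

builds on p205010 (kernel theorem, internal audit signed; external expert review pending).

van den Berg–Häggström–Kahn (Random Structures Algorithms 29 (2006)), Thm 1.5 (p. 7, eq. (9)):
for BOND percolation, given `{s ↮ t}`, functions of `(C_s, C_t)` increasing in `C_s` and decreasing
in `C_t` are positively associated; Thm 1.4: `C_s`, `C_t` are negatively correlated given `{s ↮ t}`.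
Tree (bond): `BHK2006_twoClusterConditionalAssociation_holds` (`TwoClusterConditionalAssociationProofs.lean`).
The printed theorem is bond-only; the p205010 chain uses Thm 1.4 (with sets) at (K6), (★^H), `Y^H ≤ H`
(CHAIN-READ §3.5–§3.6).  This file proves the SITE versions (OUR theorems), by the printed proof
(pp. 7–8) with ONE substitution: conditioning on `{C_s = W}` reveals the vertices of `W` OPEN and the
vertex boundary `∂W` (and `s`, if `W = ∅`) CLOSED, so the block of revealed coordinates is
`A(W) = {s} ∪ W ∪ ∂W` (`SiteBHK2.bar`) instead of BHK's edge set `W̄`; given `{C_s = W}` and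
`t ∉ W`, `C_t` is the site cluster of `t` in the configuration with `A(W)` closed
(`siteCluster_eq_sdiff_bar`), decreasing in `W`, and the rest is verbatim: Harris in the fresh
variables, display (10) by `BHK2006.blockFubini`, and SITE Thm 1.3 (`SiteBHK.siteClusterCondPosAssoc`,
part III) with `X = {t}`.

* `SiteBHK2.siteTwoClusterCondAssoc` — site Thm 1.5 (denominator-free, under `prodBernoulli q`, any
  vertex weights; no `s ≠ t` hypothesis: for `s = t` both sides coincide);
* `SiteBHK2.siteTwoCluster_negCorrelation` — site Thm 1.4: for `F` increasing in `C_s` and `G`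
  increasing in `C_t`, `P(s↮t) ∫_{s↮t} F(C_s) G(C_t) ≤ (∫_{s↮t} F(C_s)) (∫_{s↮t} G(C_t))`.

Census (census seat, CENSUS.md §4 row BHK15): 0 violations, n ≤ 5 exhaustive (6.1 M instances).
Support file (`--supports stmt-CriticalPhenomena-4575 --as helper`); sorry-free; no `Prop` definitions.
[cite: VandenbergHaggstromKahn2005, Thms. 1.4–1.5 (p. 7), proof pp. 7–8] [cite: GrimmettPercolation1999, §1.6 p. 24]
-/

noncomputable section

namespace Summit.CriticalPhenomena.PercolationContinuityZ3.Theorems.Transplant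

namespace SiteBHK2

open MeasureTheory unitInterval
open Literature.Probability.LatticeModels (prodBernoulli)
open Literature.Probability.Percolation
open Literature.Probability.Percolation.BHK2006 (weight weight_nonneg blockFubini harris_anti_anti
  integral_prodBernoulli_eq_sum)
open scoped Classical
open DecisionTree (ind ind_of_mem ind_of_not_mem ind_nonneg)

variable {V : Type*} (Γ : SimpleGraph V)

/-! ### The revealed block `A(W) = {s} ∪ W ∪ ∂W` and the coupling of `C_t` given `C_s = W` -/

/-- The block of coordinates revealed by `{C_s = W}` in the SITE model: `s`, the vertices of `W`
(open) and their neighbours (closed). (Site replacement of BHK's `W̄`, p. 8.)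
[cite: VandenbergHaggstromKahn2005, §1 p. 8 (`W̄`)] -/
def bar (s : V) (W : Set V) : Set V := {v | v = s ∨ v ∈ W ∨ ∃ u ∈ W, Γ.Adj v u}

variable {Γ}

/-- `A(W)` is increasing in `W`. [cite: VandenbergHaggstromKahn2005, §1 p. 8] -/
theorem bar_mono (s : V) : Monotone (bar Γ s) := by
  rintro W W' h v (hv | hv | ⟨u, hu, hvu⟩)
  · exact Or.inl hv
  · exact Or.inr (Or.inl (h hv))
  · exact Or.inr (Or.inr ⟨u, h hu, hvu⟩)

/-- The site cluster is increasing in the configuration. [folklore] -/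
theorem siteCluster_mono (t : V) {ω ω' : Set V} (h : ω ⊆ ω') : siteCluster Γ ω t ⊆ siteCluster Γ ω' t := by
  intro y hy
  obtain ⟨ht, hyo, hr⟩ := hy
  refine ⟨h ht, h hyo, hr.mono ?_⟩
  intro a b hab
  rw [siteOpenGraph_adj] at hab ⊢
  exact ⟨hab.1, h hab.2.1, h hab.2.2⟩

/-- Deleting `B` twice is deleting it once. [folklore] -/
theorem siteCluster_sdiff_sdiff (t : V) (B η : Set V) :
    siteCluster Γ ((η \ B) \ B) t = siteCluster Γ (η \ B) t := by
  rw [Set.sdiff_sdiff, Set.union_self]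

/-- On `{C_s = W}`, an OPEN vertex of the block `A(W)` lies in `W` (the vertices of `∂W`, and `s`
when `W = ∅`, are closed). [folklore] -/
theorem mem_of_mem_bar_of_mem {s : V} {W ω : Set V} (hW : siteCluster Γ ω s = W) {v : V}
    (hv : v ∈ bar Γ s W) (hvo : v ∈ ω) : v ∈ W := by
  rcases hv with rfl | hv | ⟨u, hu, hvu⟩
  · rw [← hW]; exact ⟨hvo, hvo, SimpleGraph.Reachable.refl _⟩
  · exact hv
  · rw [← hW] at hu ⊢
    obtain ⟨hs, huo, hr⟩ := hu
    refine ⟨hs, hvo, hr.trans (SimpleGraph.Adj.reachable ?_)⟩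
    rw [siteOpenGraph_adj]; exact ⟨hvu.symm, huo, hvo⟩

/-- **Locality of `{C_s = W}`** (site): two configurations agreeing on `A(W)` lie in `{C_s = W}`
together. [cite: VandenbergHaggstromKahn2005, §1 p. 8 (conditioning on `{C_s = W}`)] -/
theorem siteCluster_eq_of_agree {s : V} {W ω ω' : Set V}
    (hag : ∀ v, v ∈ bar Γ s W → (v ∈ ω ↔ v ∈ ω')) (hW : siteCluster Γ ω s = W) :
    siteCluster Γ ω' s = W := by
  have hs : s ∈ bar Γ s W := Or.inl rfl
  by_cases hso : s ∈ ω
  · have hso' : s ∈ ω' := (hag s hs).1 hso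
    -- every vertex of `W` is joined to `s` inside `W`, in both configurations
    have hWo : ∀ v ∈ W, v ∈ ω := fun v hv => by rw [← hW] at hv; exact hv.2.1
    have h1 : ∀ v, (siteOpenGraph Γ ω').Reachable s v → v ∈ ω' →
        (siteOpenGraph Γ ω).Reachable s v ∧ v ∈ W := by
      intro v hv
      rw [SimpleGraph.reachable_iff_reflTransGen] at hv
      induction hv with
      | refl => intro _; exact ⟨SimpleGraph.Reachable.refl s, by rw [← hW]; exact ⟨hso, hso, SimpleGraph.Reachable.refl s⟩⟩
      | @tail b c _ hbc ih =>
        intro hco'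
        rw [siteOpenGraph_adj] at hbc
        obtain ⟨hb, hbW⟩ := ih hbc.2.1
        -- `c` is a neighbour of `b ∈ W`, hence in the block; it is open in `ω'`, so open in `ω`
        have hcA : c ∈ bar Γ s W := Or.inr (Or.inr ⟨b, hbW, hbc.1.symm⟩)
        have hco : c ∈ ω := (hag c hcA).2 hco'
        have hc : (siteOpenGraph Γ ω).Reachable s c := hb.trans (SimpleGraph.Adj.reachable (by
          rw [siteOpenGraph_adj]; exact ⟨hbc.1, hWo b hbW, hco⟩))
        exact ⟨hc, by rw [← hW]; exact ⟨hso, hco, hc⟩⟩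
    have h2 : ∀ v, (siteOpenGraph Γ ω).Reachable s v → v ∈ ω → (siteOpenGraph Γ ω').Reachable s v := by
      intro v hv
      rw [SimpleGraph.reachable_iff_reflTransGen] at hv
      induction hv with
      | refl => intro _; exact SimpleGraph.Reachable.refl s
      | @tail b c hab hbc ih =>
        intro _
        rw [siteOpenGraph_adj] at hbc
        have hbW : b ∈ W := by
          rw [← hW]; exact ⟨hso, hbc.2.1, (SimpleGraph.reachable_iff_reflTransGen s b).2 hab⟩
        have hcW : c ∈ W := by
          rw [← hW]
          exact ⟨hso, hbc.2.2, ((SimpleGraph.reachable_iff_reflTransGen s b).2 hab).trans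
            (SimpleGraph.Adj.reachable (by rw [siteOpenGraph_adj]; exact hbc))⟩
        have hbo' : b ∈ ω' := (hag b (Or.inr (Or.inl hbW))).1 hbc.2.1
        have hco' : c ∈ ω' := (hag c (Or.inr (Or.inl hcW))).1 hbc.2.2
        exact (ih hbc.2.1).trans (SimpleGraph.Adj.reachable (by
          rw [siteOpenGraph_adj]; exact ⟨hbc.1, hbo', hco'⟩))
    ext y
    constructor
    · rintro ⟨_, hyo', hr⟩
      exact (h1 y hr hyo').2
    · intro hy
      have hy' : y ∈ siteCluster Γ ω s := by rw [hW]; exact hy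
      exact ⟨hso', (hag y (Or.inr (Or.inl hy))).1 hy'.2.1, h2 y hy'.2.2 hy'.2.1⟩
  · have hW0 : W = ∅ := by
      rw [← hW]; exact Set.eq_empty_of_forall_notMem fun y hy => hso hy.1
    have hso' : s ∉ ω' := fun h => hso ((hag s hs).2 h)
    rw [hW0]
    exact Set.eq_empty_of_forall_notMem fun y hy => hso' hy.1

/-- `{C_s = W}` is a cylinder event on `A(W)`. [folklore] -/
theorem siteCluster_inter_bar_eq_iff (s : V) (W ω : Set V) :
    siteCluster Γ (ω ∩ bar Γ s W) s = W ↔ siteCluster Γ ω s = W :=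
  ⟨fun h => siteCluster_eq_of_agree (ω := ω ∩ bar Γ s W) (ω' := ω)
      (fun _ hv => ⟨fun h' => h'.1, fun h' => ⟨h', hv⟩⟩) h,
    fun h => siteCluster_eq_of_agree (ω := ω) (ω' := ω ∩ bar Γ s W)
      (fun _ hv => ⟨fun h' => ⟨h', hv⟩, fun h' => h'.1⟩) h⟩

/-- **`C_t` given `C_s = W`** (site): on `{C_s = W}` with `t ∉ W` (i.e. `s ↮ t`), the site cluster of
`t` is its site cluster in the configuration with the block `A(W)` closed.
[cite: VandenbergHaggstromKahn2005, §1 p. 8 (proof of Thm. 1.5)] -/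
theorem siteCluster_eq_sdiff_bar {s t : V} {W ω : Set V} (hW : siteCluster Γ ω s = W) (ht : t ∉ W) :
    siteCluster Γ ω t = siteCluster Γ (ω \ bar Γ s W) t := by
  -- an open vertex joined to `t` is not in the block
  have hnot : ∀ v, v ∈ siteCluster Γ ω t → v ∉ bar Γ s W := by
    intro v hv hvA
    have hvW : v ∈ W := mem_of_mem_bar_of_mem hW hvA hv.2.1
    rw [← hW] at hvW
    apply ht
    rw [← hW]
    exact ⟨hvW.1, hv.1, hvW.2.2.trans hv.2.2.symm⟩
  apply Set.Subset.antisymm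
  · intro y hy
    have hto : t ∈ ω := hy.1
    have htA : t ∉ bar Γ s W := hnot t ⟨hto, hto, SimpleGraph.Reachable.refl t⟩
    have hreach : ∀ v, (siteOpenGraph Γ ω).Reachable t v → v ∈ ω →
        (siteOpenGraph Γ (ω \ bar Γ s W)).Reachable t v := by
      intro v hv
      rw [SimpleGraph.reachable_iff_reflTransGen] at hv
      induction hv with
      | refl => intro _; exact SimpleGraph.Reachable.refl t
      | @tail b c hab hbc ih =>
        intro hco
        rw [siteOpenGraph_adj] at hbc
        have hb : (siteOpenGraph Γ ω).Reachable t b := (SimpleGraph.reachable_iff_reflTransGen t b).2 hab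
        have hbA := hnot b ⟨hto, hbc.2.1, hb⟩
        have hcA := hnot c ⟨hto, hbc.2.2, hb.trans (SimpleGraph.Adj.reachable (by
          rw [siteOpenGraph_adj]; exact hbc))⟩
        exact (ih hbc.2.1).trans (SimpleGraph.Adj.reachable (by
          rw [siteOpenGraph_adj]; exact ⟨hbc.1, ⟨hbc.2.1, hbA⟩, ⟨hbc.2.2, hcA⟩⟩))
    exact ⟨⟨hto, htA⟩, ⟨hy.2.1, hnot y hy⟩, hreach y hy.2.2 hy.2.1⟩
  · exact siteCluster_mono t Set.sdiff_subset

/-! ### Conditional expectations given `C_s = W` as finite sums -/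

variable [Fintype V]

/-- `W ↦ Σ_η weight(η) H(W, C_t(η ∖ A(W)))` is increasing for `H` increasing/decreasing.
[cite: VandenbergHaggstromKahn2005, §1 p. 8] -/
theorem condAvg_mono {q : V → ℝ} (hq0 : ∀ v, 0 ≤ q v) (hq1 : ∀ v, q v ≤ 1) (s t : V)
    {H : Set V → Set V → ℝ} (hH1 : ∀ D, Monotone fun C => H C D) (hH2 : ∀ C, Antitone fun D => H C D) :
    Monotone fun W => ∑ η, weight q η * H W (siteCluster Γ (η \ bar Γ s W) t) := by
  intro W W' hWW'
  refine Finset.sum_le_sum fun η _ => mul_le_mul_of_nonneg_left ?_ (weight_nonneg hq0 hq1 η)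
  exact (hH1 _ hWW').trans
    (hH2 W' (siteCluster_mono t (Set.sdiff_subset_sdiff_right (bar_mono s hWW'))))

/-- Harris in the fresh variables: `E[f g | C_s = W] ≥ E[f | C_s = W] E[g | C_s = W]`.
[cite: VandenbergHaggstromKahn2005, §1 p. 8] -/
theorem condAvg_mul_le {q : V → ℝ} (hq0 : ∀ v, 0 ≤ q v) (hq1 : ∀ v, q v ≤ 1)
    (hm : ∑ ω, weight q ω = 1) (t : V) (B : Set V) {F G : Set V → Set V → ℝ}
    (hF2 : ∀ C, Antitone fun D => F C D) (hG2 : ∀ C, Antitone fun D => G C D) (W : Set V) :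
    (∑ η, weight q η * F W (siteCluster Γ (η \ B) t)) * ∑ η, weight q η * G W (siteCluster Γ (η \ B) t) ≤
      ∑ η, weight q η * (F W (siteCluster Γ (η \ B) t) * G W (siteCluster Γ (η \ B) t)) :=
  harris_anti_anti hq0 hq1 hm (f := fun η => F W (siteCluster Γ (η \ B) t))
    (g := fun η => G W (siteCluster Γ (η \ B) t))
    (fun _ _ hab => hF2 W (siteCluster_mono t (Set.sdiff_subset_sdiff_left hab)))
    (fun _ _ hab => hG2 W (siteCluster_mono t (Set.sdiff_subset_sdiff_left hab)))
    (M := F W ∅) (N := G W ∅) (fun _ => hF2 W (Set.empty_subset _)) (fun _ => hG2 W (Set.empty_subset _))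

/-- **Display (10) with the domain Markov property** (site): for any `H`,
`E[H(C_s, C_t) 1{t ∉ C_s}] = Σ_ω weight(ω) (Σ_η weight(η) H(C_s(ω), C_t(η ∖ A(C_s ω)))) 1{t ∉ C_s}(ω)`.
[cite: VandenbergHaggstromKahn2005, §1 pp. 7–8, display (10)] -/
theorem sum_cond_cluster (q : V → ℝ) (hm : ∑ ω, weight q ω = 1) (s t : V) (H : Set V → Set V → ℝ)
    {D : Set (Set V)} (hD : ∀ ω, ω ∈ D ↔ t ∉ siteCluster Γ ω s) :
    ∑ ω, weight q ω * (H (siteCluster Γ ω s) (siteCluster Γ ω t) * ind D ω) =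
      ∑ ω, weight q ω * ((∑ η, weight q η *
        H (siteCluster Γ ω s) (siteCluster Γ (η \ bar Γ s (siteCluster Γ ω s)) t)) * ind D ω) := by
  have key : ∀ W : Set V,
      ∑ ω, (if siteCluster Γ ω s = W then weight q ω * (H W (siteCluster Γ ω t) * ind D ω) else 0) =
      ∑ ω, (if siteCluster Γ ω s = W then
          weight q ω * ((∑ η, weight q η * H W (siteCluster Γ (η \ bar Γ s W) t)) * ind D ω) else 0) := by
    intro W
    by_cases ht : t ∈ W
    · refine Finset.sum_congr rfl fun ω _ => ?_
      split_ifs with hW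
      · have hr : t ∈ siteCluster Γ ω s := by rw [hW]; exact ht
        simp only [ind_of_not_mem (fun h => (hD ω).1 h hr), mul_zero]
      · rfl
    · set A : Set V := bar Γ s W with hA
      set Φ : Set V → Set V → ℝ := fun ζ η =>
        if siteCluster Γ ζ s = W then H W (siteCluster Γ (η \ A) t) else 0 with hΦ
      have hind : ∀ ω, siteCluster Γ ω s = W → ind D ω = 1 := fun ω hW =>
        ind_of_mem ((hD ω).2 (by rw [hW]; exact ht))
      have h1 : ∀ ω, (if siteCluster Γ ω s = W then weight q ω * (H W (siteCluster Γ ω t) * ind D ω) else 0) =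
          weight q ω * Φ (ω ∩ A) (ω \ A) := by
        intro ω
        simp only [hΦ, hA, siteCluster_inter_bar_eq_iff, siteCluster_sdiff_sdiff]
        split_ifs with hW
        · rw [hind ω hW, mul_one, siteCluster_eq_sdiff_bar hW ht]
        · rw [mul_zero]
      have h2 : ∀ ω, weight q ω * ∑ ω', weight q ω' * Φ (ω ∩ A) (ω' \ A) =
          (if siteCluster Γ ω s = W then
            weight q ω * ((∑ η, weight q η * H W (siteCluster Γ (η \ A) t)) * ind D ω) else 0) := by
        intro ω
        simp only [hΦ, hA, siteCluster_inter_bar_eq_iff, siteCluster_sdiff_sdiff]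
        split_ifs with hW
        · rw [hind ω hW, mul_one]
        · simp
      calc ∑ ω, (if siteCluster Γ ω s = W then weight q ω * (H W (siteCluster Γ ω t) * ind D ω) else 0)
          = (∑ ω, weight q ω) * ∑ ω, weight q ω * Φ (ω ∩ A) (ω \ A) := by
            rw [hm, one_mul]; exact Finset.sum_congr rfl fun ω _ => h1 ω
        _ = ∑ ω, weight q ω * ∑ ω', weight q ω' * Φ (ω ∩ A) (ω' \ A) := blockFubini q A Φ
        _ = _ := Finset.sum_congr rfl fun ω _ => h2 ω
  calc ∑ ω, weight q ω * (H (siteCluster Γ ω s) (siteCluster Γ ω t) * ind D ω)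
      = ∑ ω, ∑ W, (if siteCluster Γ ω s = W then weight q ω * (H W (siteCluster Γ ω t) * ind D ω) else 0) :=
        Finset.sum_congr rfl fun ω _ => (Fintype.sum_ite_eq (siteCluster Γ ω s)
          fun W => weight q ω * (H W (siteCluster Γ ω t) * ind D ω)).symm
    _ = ∑ W, ∑ ω, (if siteCluster Γ ω s = W then weight q ω * (H W (siteCluster Γ ω t) * ind D ω) else 0) :=
        Finset.sum_comm
    _ = ∑ W, ∑ ω, (if siteCluster Γ ω s = W then
          weight q ω * ((∑ η, weight q η * H W (siteCluster Γ (η \ bar Γ s W) t)) * ind D ω) else 0) :=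
        Finset.sum_congr rfl fun W _ => key W
    _ = ∑ ω, ∑ W, (if siteCluster Γ ω s = W then
          weight q ω * ((∑ η, weight q η * H W (siteCluster Γ (η \ bar Γ s W) t)) * ind D ω) else 0) :=
        Finset.sum_comm
    _ = _ := Finset.sum_congr rfl fun ω _ => Fintype.sum_ite_eq (siteCluster Γ ω s)
          fun W => weight q ω * ((∑ η, weight q η * H W (siteCluster Γ (η \ bar Γ s W) t)) * ind D ω)

/-! ### Site Theorems 1.5 and 1.4 -/

/-- **SITE van den Berg–Häggström–Kahn Theorem 1.5 (OURS; the printed theorem is bond-only).** For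
site percolation with arbitrary vertex weights on a finite graph, vertices `s, t` and functions
`F, G` of `(C_s, C_t)` increasing in the site cluster `C_s` and decreasing in `C_t`:
`(∫_D F)(∫_D G) ≤ P(D) ∫_D F G` with `D = {t ∉ C_s} = {s ↮ t}`.  Printed proof transplanted:
display (10), Harris in the variables off `A(C_s) = {s} ∪ C_s ∪ ∂C_s`, monotonicity in `W`, and
site Thm 1.3 (`SiteBHK.siteClusterCondPosAssoc`) with `X = {t}`.
[cite: VandenbergHaggstromKahn2005, Thm. 1.5 (p. 7, eq. (9)), proof pp. 7–8] -/
theorem siteTwoClusterCondAssoc (q : V → unitInterval) (s t : V) (F G : Set V → Set V → ℝ)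
    (hF1 : ∀ D, Monotone fun C => F C D) (hF2 : ∀ C, Antitone fun D => F C D)
    (hG1 : ∀ D, Monotone fun C => G C D) (hG2 : ∀ C, Antitone fun D => G C D) :
    (∫ ω in {ω | t ∉ siteCluster Γ ω s}, F (siteCluster Γ ω s) (siteCluster Γ ω t) ∂(prodBernoulli q)) *
      (∫ ω in {ω | t ∉ siteCluster Γ ω s}, G (siteCluster Γ ω s) (siteCluster Γ ω t) ∂(prodBernoulli q)) ≤
    (prodBernoulli q).real {ω | t ∉ siteCluster Γ ω s} *
      ∫ ω in {ω | t ∉ siteCluster Γ ω s}, F (siteCluster Γ ω s) (siteCluster Γ ω t) *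
        G (siteCluster Γ ω s) (siteCluster Γ ω t) ∂(prodBernoulli q) := by
  set D : Set (Set V) := {ω | t ∉ siteCluster Γ ω s} with hD
  have hDmem : ∀ ω, ω ∈ D ↔ t ∉ siteCluster Γ ω s := fun ω => by rw [hD]; rfl
  have hDm : MeasurableSet D := MeasurableSet.of_discrete
  set q' : V → ℝ := fun v => (q v : ℝ) with hq'
  have hq0 : ∀ v, 0 ≤ q' v := fun v => (q v).2.1
  have hq1 : ∀ v, q' v ≤ 1 := fun v => (q v).2.2
  have hint : ∀ h : Set V → ℝ, ∫ ω in D, h ω ∂(prodBernoulli q) = ∑ ω, weight q' ω * (h ω * ind D ω) := by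
    intro h
    rw [← integral_indicator hDm, integral_prodBernoulli_eq_sum]
    refine Finset.sum_congr rfl fun ω _ => ?_
    by_cases hω : ω ∈ D
    · rw [Set.indicator_of_mem hω, ind_of_mem hω, mul_one]
    · rw [Set.indicator_of_notMem hω, ind_of_not_mem hω]; ring
  have hreal : (prodBernoulli q).real D = ∑ ω, weight q' ω * ind D ω := by
    rw [← integral_indicator_one hDm, integral_prodBernoulli_eq_sum]
    refine Finset.sum_congr rfl fun ω _ => ?_
    by_cases hω : ω ∈ D
    · rw [Set.indicator_of_mem hω, ind_of_mem hω, Pi.one_apply]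
    · rw [Set.indicator_of_notMem hω, ind_of_not_mem hω, mul_zero]
  have hm : ∑ ω, weight q' ω = 1 := by
    have h1 := integral_prodBernoulli_eq_sum q fun _ => (1 : ℝ)
    simp only [integral_const, probReal_univ, smul_eq_mul, mul_one] at h1
    exact h1.symm
  -- `E[f | C_s = W]`, `E[g | C_s = W]` increasing in `W`; SITE Thm 1.3 with `X = {t}`
  have hf₁ : Monotone fun W => ∑ η, weight q' η * F W (siteCluster Γ (η \ bar Γ s W) t) :=
    condAvg_mono hq0 hq1 s t hF1 hF2
  have hg₁ : Monotone fun W => ∑ η, weight q' η * G W (siteCluster Γ (η \ bar Γ s W) t) :=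
    condAvg_mono hq0 hq1 s t hG1 hG2
  have h13 := SiteBHK.siteClusterCondPosAssoc (Γ := Γ) q s ({t} : Set V)
    (fun W => ∑ η, weight q' η * F W (siteCluster Γ (η \ bar Γ s W) t))
    (fun W => ∑ η, weight q' η * G W (siteCluster Γ (η \ bar Γ s W) t)) hf₁ hg₁
  have hDt : {ω : Set V | ∀ x ∈ ({t} : Set V), x ∉ siteCluster Γ ω s} = D := by
    ext ω
    simp only [Set.mem_setOf_eq, Set.mem_singleton_iff, forall_eq, hDmem]
  rw [hDt] at h13
  rw [hint, hint, hint (fun ω =>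
    (∑ η, weight q' η * F (siteCluster Γ ω s) (siteCluster Γ (η \ bar Γ s (siteCluster Γ ω s)) t)) *
    ∑ η, weight q' η * G (siteCluster Γ ω s) (siteCluster Γ (η \ bar Γ s (siteCluster Γ ω s)) t)), hreal] at h13
  rw [hint (fun ω => F (siteCluster Γ ω s) (siteCluster Γ ω t)),
    hint (fun ω => G (siteCluster Γ ω s) (siteCluster Γ ω t)),
    hint (fun ω => F (siteCluster Γ ω s) (siteCluster Γ ω t) * G (siteCluster Γ ω s) (siteCluster Γ ω t)), hreal]
  have e1 := sum_cond_cluster (Γ := Γ) q' hm s t F hDmem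
  have e2 := sum_cond_cluster (Γ := Γ) q' hm s t G hDmem
  have e3 := sum_cond_cluster (Γ := Γ) q' hm s t (fun C C' => F C C' * G C C') hDmem
  have hH : ∑ ω, weight q' ω *
      ((∑ η, weight q' η * F (siteCluster Γ ω s) (siteCluster Γ (η \ bar Γ s (siteCluster Γ ω s)) t)) *
      (∑ η, weight q' η * G (siteCluster Γ ω s) (siteCluster Γ (η \ bar Γ s (siteCluster Γ ω s)) t)) * ind D ω) ≤
      ∑ ω, weight q' ω * ((∑ η, weight q' η *
        (F (siteCluster Γ ω s) (siteCluster Γ (η \ bar Γ s (siteCluster Γ ω s)) t) *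
        G (siteCluster Γ ω s) (siteCluster Γ (η \ bar Γ s (siteCluster Γ ω s)) t))) * ind D ω) :=
    Finset.sum_le_sum fun ω _ => mul_le_mul_of_nonneg_left
      (mul_le_mul_of_nonneg_right (condAvg_mul_le hq0 hq1 hm t _ hF2 hG2 _) (ind_nonneg _ _))
      (weight_nonneg hq0 hq1 ω)
  have hP : 0 ≤ ∑ ω, weight q' ω * ind D ω :=
    Finset.sum_nonneg fun ω _ => mul_nonneg (weight_nonneg hq0 hq1 ω) (ind_nonneg _ _)
  show (∑ ω, weight q' ω * (F (siteCluster Γ ω s) (siteCluster Γ ω t) * ind D ω)) *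
      (∑ ω, weight q' ω * (G (siteCluster Γ ω s) (siteCluster Γ ω t) * ind D ω)) ≤
    (∑ ω, weight q' ω * ind D ω) *
      ∑ ω, weight q' ω * (F (siteCluster Γ ω s) (siteCluster Γ ω t) * G (siteCluster Γ ω s) (siteCluster Γ ω t) * ind D ω)
  rw [e1, e2, e3]
  exact h13.trans (mul_le_mul_of_nonneg_left hH hP)

/-- **SITE van den Berg–Häggström–Kahn Theorem 1.4 — `C_s` and `C_t` are negatively correlated given
`{s ↮ t}`** (site form; from site Thm 1.5 for the pair `(F, −G)`): for `F, G` increasing,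
`P(D) ∫_D F(C_s) G(C_t) ≤ (∫_D F(C_s)) (∫_D G(C_t))`, `D = {t ∉ C_s}`.
[cite: VandenbergHaggstromKahn2005, Thm. 1.4 (p. 7)] -/
theorem siteTwoCluster_negCorrelation (q : V → unitInterval) (s t : V) (F G : Set V → ℝ)
    (hF : Monotone F) (hG : Monotone G) :
    (prodBernoulli q).real {ω | t ∉ siteCluster Γ ω s} *
      (∫ ω in {ω | t ∉ siteCluster Γ ω s}, F (siteCluster Γ ω s) * G (siteCluster Γ ω t) ∂(prodBernoulli q)) ≤
    (∫ ω in {ω | t ∉ siteCluster Γ ω s}, F (siteCluster Γ ω s) ∂(prodBernoulli q)) *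
      ∫ ω in {ω | t ∉ siteCluster Γ ω s}, G (siteCluster Γ ω t) ∂(prodBernoulli q) := by
  have key := siteTwoClusterCondAssoc (Γ := Γ) q s t (fun C _ => F C) (fun _ D => -G D) (fun _ => hF)
    (fun _ => antitone_const) (fun _ => monotone_const) (fun _ _ _ hDD' => neg_le_neg (hG hDD'))
  simp only [mul_neg, integral_neg] at key
  linarith

end SiteBHK2

end Summit.CriticalPhenomena.PercolationContinuityZ3.Theorems.Transplant
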